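import Literature.Probability.Percolation.TriCoarseTiling
import Literature.Probability.Percolation.TriOneBlock
import HarnessLib

/-!
# One-block ring patterns from local implications («CYCLIC-BLOCK-CRITERIA»)

Topic `Literature/Probability/Percolation`; family `crit-perc`; a rider on `TriOneBlock.lean` (`OneBlockAt G x`: the neighbours of `x` in `G` form one cyclic block of directions;
`TriMarkedDomain.ofOneBlock`: one-block patterns at every site and outer site ⇒ no cut vertices ⇒ a discrete domain) and `TriCoarseTiling.lean` (`IsCyclicBlock`: the same for a
Boolean pattern on `Fin 6`, DECIDABLE; used there for unions of tiles by a finite check).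

For a family of site sets described by COORDINATE RULES (the sandpile class of HOME `FINDING-BSPAN-SLIDE-INDUCTION.md` (G0): a base parallelogram with supported cells hanging below it)
the ring pattern at a site is not known explicitly, but it obeys a few IMPLICATIONS between the six membership bits (a hanging neighbour forces its two supporters; nothing hangs
from an outer site). This file turns such implication sets into `OneBlockAt` by finite checks over the `64` patterns:

* `oneBlockAt_iff_isCyclicBlock` — the bridge `OneBlockAt G x ⟺ IsCyclicBlock (j ↦ [x + e_j ∈ G])`; `isCyclicBlock_shift_iff` — rotating a pattern keeps it one block;
* ★ `isCyclicBlock_of_lower` — **bits 4, 5 off and `0 ⇒ 1`, `3 ⇒ 2`** ⇒ one block (an outer site BELOW a supported pile: nothing hangs from it, and a hanging neighbour to its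
  left/right forces the common upper neighbour); ★ `isCyclicBlock_of_hanging` — **bits 1, 2 on and `4 ⇒ 3`, `5 ⇒ 0`** ⇒ one block (a hanging cell: its two supporters are in,
  a cell hanging from it forces the other supporter); `isCyclicBlock_of_four` — bits 0–3 on ⇒ one block (a bottom-row base cell); `isCyclicBlock_of_two_off_mono` — bits `a+4`,
  `a+5` off and `a ⇒ a+1`, `a+3 ⇒ a+2` for any rotation `a` (outer sites along any locally convex side);
* the `OneBlockAt` wrappers ★ `oneBlockAt_of_lower`, ★ `oneBlockAt_of_hanging`, `oneBlockAt_of_four`, `oneBlockAt_of_two_off_mono` (directions `triDir`: `e₀ = (1,0)`, `e₁ = (0,1)`,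
  `e₂ = (−1,1)`, `e₃ = (−1,0)`, `e₄ = (0,−1)`, `e₅ = (1,−1)`; a cell `(x,y)` «hangs» from `(x,y)+e₁` and `(x,y)+e₂`).

## References
* B. Bollobás, O. Riordan, *Percolation*, Cambridge University Press (2006), Ch. 7 §7.2.2 p. 168 («neither `G` nor `∂⁺(G)` has a cut-vertex»).

## Mathlib / tree
Tree: `TriOneBlock` (`OneBlockAt`), `TriCoarseTiling` (`IsCyclicBlock`, its `DecidablePred` instance), `TriDiscShelling` (`triDir`). Mathlib: `decide`, `Bool.decide_*`.
-/

noncomputable section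

open Finset Literature.Probability.LatticeModels

namespace Literature.Probability.Percolation

/-! ### Boolean patterns -/

/-- **the bridge**: the one-block condition at a site is the cyclic-block property of its membership pattern. [cite: BollobasRiordan2006, Ch. 7 §7.2.2 p. 168; lane plumbing] -/
theorem oneBlockAt_iff_isCyclicBlock (G : Finset (Site 2)) (x : Site 2) :
    OneBlockAt G x ↔ IsCyclicBlock fun j => decide (x + triDir j ∈ G) := by
  unfold OneBlockAt IsCyclicBlock
  simp only [decide_eq_true_eq, decide_eq_false_iff_not]

set_option maxHeartbeats 400000 in
/-- **rotating a pattern keeps it one block** (a finite check over the `64 × 6` cases; budgeted). [cite: BollobasRiordan2006, Ch. 7 §7.2.2 p. 168; lane plumbing] -/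
theorem isCyclicBlock_shift_iff (g : Fin 6 → Bool) (a : Fin 6) : IsCyclicBlock (fun j => g (a + j)) ↔ IsCyclicBlock g := by
  revert g a; decide

/-- ★ **below a pile**: bits `4`, `5` off, `0 ⇒ 1`, `3 ⇒ 2` ⇒ one block. [cite: BollobasRiordan2006, Ch. 7 §7.2.2 p. 168; lane plumbing] -/
theorem isCyclicBlock_of_lower (g : Fin 6 → Bool) (h4 : g 4 = false) (h5 : g 5 = false) (h01 : g 0 = true → g 1 = true)
    (h32 : g 3 = true → g 2 = true) : IsCyclicBlock g := by
  revert g; decide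

/-- ★ **a hanging cell**: bits `1`, `2` on, `4 ⇒ 3`, `5 ⇒ 0` ⇒ one block. [cite: BollobasRiordan2006, Ch. 7 §7.2.2 p. 168; lane plumbing] -/
theorem isCyclicBlock_of_hanging (g : Fin 6 → Bool) (h1 : g 1 = true) (h2 : g 2 = true) (h43 : g 4 = true → g 3 = true)
    (h50 : g 5 = true → g 0 = true) : IsCyclicBlock g := by
  revert g; decide

/-- **a bottom-row cell of a thick base**: bits `0`–`3` on ⇒ one block (whatever hangs below). [cite: BollobasRiordan2006, Ch. 7 §7.2.2 p. 168; lane plumbing] -/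
theorem isCyclicBlock_of_four (g : Fin 6 → Bool) (h0 : g 0 = true) (h1 : g 1 = true) (h2 : g 2 = true) (h3 : g 3 = true) : IsCyclicBlock g := by
  revert g; decide

/-- **along any locally convex side** (rotation `a` of the «below» pattern): bits `a+4`, `a+5` off, `a ⇒ a+1`, `a+3 ⇒ a+2` ⇒ one block.
[cite: BollobasRiordan2006, Ch. 7 §7.2.2 p. 168; lane plumbing] -/
theorem isCyclicBlock_of_two_off_mono (g : Fin 6 → Bool) (a : Fin 6) (h4 : g (a + 4) = false) (h5 : g (a + 5) = false)
    (h01 : g a = true → g (a + 1) = true) (h32 : g (a + 3) = true → g (a + 2) = true) : IsCyclicBlock g := by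
  rw [← isCyclicBlock_shift_iff g a]
  exact isCyclicBlock_of_lower _ h4 h5 (by simpa using h01) h32

/-! ### The `OneBlockAt` wrappers -/

variable {G : Finset (Site 2)} {x : Site 2}

/-- ★ **an outer site below a supported pile has a one-block pattern**: if nothing hangs from `x` (`x + e₄, x + e₅ ∉ G`) and a lower-left / lower-right neighbour in `G` forces the
common upper neighbour (`x + e₀ ∈ G → x + e₁ ∈ G`, `x + e₃ ∈ G → x + e₂ ∈ G`). [cite: BollobasRiordan2006, Ch. 7 §7.2.2 p. 168] -/
theorem oneBlockAt_of_lower (h4 : x + triDir 4 ∉ G) (h5 : x + triDir 5 ∉ G) (h01 : x + triDir 0 ∈ G → x + triDir 1 ∈ G)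
    (h32 : x + triDir 3 ∈ G → x + triDir 2 ∈ G) : OneBlockAt G x := by
  rw [oneBlockAt_iff_isCyclicBlock]
  exact isCyclicBlock_of_lower _ (by simpa using h4) (by simpa using h5) (by simpa using h01) (by simpa using h32)

/-- ★ **a hanging cell has a one-block pattern**: its supporters `x + e₁`, `x + e₂` are in `G`, and a cell hanging from it forces the other supporter (`x + e₄ ∈ G → x + e₃ ∈ G`,
`x + e₅ ∈ G → x + e₀ ∈ G`). [cite: BollobasRiordan2006, Ch. 7 §7.2.2 p. 168] -/
theorem oneBlockAt_of_hanging (h1 : x + triDir 1 ∈ G) (h2 : x + triDir 2 ∈ G) (h43 : x + triDir 4 ∈ G → x + triDir 3 ∈ G)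
    (h50 : x + triDir 5 ∈ G → x + triDir 0 ∈ G) : OneBlockAt G x := by
  rw [oneBlockAt_iff_isCyclicBlock]
  exact isCyclicBlock_of_hanging _ (by simpa using h1) (by simpa using h2) (by simpa using h43) (by simpa using h50)

/-- **a cell with its four neighbours in directions `0`–`3` in `G` has a one-block pattern** (bottom row of a thick base, anything hanging below). [cite: BollobasRiordan2006, Ch. 7 §7.2.2 p. 168] -/
theorem oneBlockAt_of_four (h0 : x + triDir 0 ∈ G) (h1 : x + triDir 1 ∈ G) (h2 : x + triDir 2 ∈ G) (h3 : x + triDir 3 ∈ G) : OneBlockAt G x := by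
  rw [oneBlockAt_iff_isCyclicBlock]
  exact isCyclicBlock_of_four _ (by simpa using h0) (by simpa using h1) (by simpa using h2) (by simpa using h3)

/-- **an outer site along a locally convex side** (rotation `a` of `oneBlockAt_of_lower`). [cite: BollobasRiordan2006, Ch. 7 §7.2.2 p. 168] -/
theorem oneBlockAt_of_two_off_mono (a : Fin 6) (h4 : x + triDir (a + 4) ∉ G) (h5 : x + triDir (a + 5) ∉ G)
    (h01 : x + triDir a ∈ G → x + triDir (a + 1) ∈ G) (h32 : x + triDir (a + 3) ∈ G → x + triDir (a + 2) ∈ G) : OneBlockAt G x := by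
  rw [oneBlockAt_iff_isCyclicBlock]
  exact isCyclicBlock_of_two_off_mono _ a (by simpa using h4) (by simpa using h5) (by simpa using h01) (by simpa using h32)

end Literature.Probability.Percolation
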